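import Literature.AlgebraicGeometry.Resolution.InseparableLocalUniformizationDescentStepZero
import HarnessLib

/-!
# Inseparable local uniformization: the conclusion of Thm. 4.1.1 before the final enlargement of `l`

Topic: `Literature/AlgebraicGeometry/Resolution`. M. Temkin, *Inseparable local uniformization*,
J. Algebra 373 (2013) 65–119 = arXiv:0804.1554v3, proof of Thm. 4.1.1, end of Step 4 (p. 49;
p. 30 of the 41-pp. arXiv version held in the literature store): "Thus, we achieve that the
center of each `Kᵢ` on `Xᵢ` is `l`-smooth, and the Theorem is proved." — in v3 followed by "In
particular, `x₁` is `l`-smooth, and, replacing `l` with a purely inseparable extension, we can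
also arrange that `x₁` is a simple `l`-smooth point" (a smooth point `x` of an `l`-variety being
*simple* if `k(x)/l` is separable, p. 4).

The tree's rendering of the conclusion of Thm. 4.1.1 (`n = 1`, non-logarithmic) for one model
and one valued extension, `Temkin2013DescentConclusion`
(`InseparableLocalUniformizationDescentStepZero.lean`), asks for the centre `x₁` to be
`l`-smooth AND simple (`Algebra.FormallySmooth l k(x₁)`) AND regular. Steps 3–4 of the printed
proof deliver `l`-smoothness; simplicity is the separate final enlargement of `l`, and regularity
is "smooth over a field ⇒ regular". To formalize Steps 3–4 and that final enlargement as
separate theorems this file introduces the intermediate shape: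

* `Temkin2013DescentConclusionWeak k K O A K₁ O₁` — verbatim `Temkin2013DescentConclusion`
  with the last two conjuncts (formal smoothness of the residue field of the centre over `l`,
  regularity of its local ring) dropped: the centre of `L₁°` on `Nr_{L₁}(X′)` is `l`-smooth.
* `Temkin2013DescentConclusion.weak` — PROVED: the full conclusion implies the weak one.
* `Temkin2013DescentConclusionWeak.of_le` — PROVED: refining the model is harmless.

The converse direction (weak ⇒ full: "replacing `l` with a purely inseparable extension, we can
also arrange that `x₁` is a simple `l`-smooth point", plus EGA IV 17.5.8 (iii)
`isRegularLocalRing_of_isSmoothAt`) is the subject of a companion proof file.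

## Source

* M. Temkin, *Inseparable local uniformization*, arXiv:0804.1554v3, Thm. 4.1.1 and its proof,
  Step 4 (pp. 47–49); p. 4 (simple smooth points).
-/

noncomputable section

namespace Literature.AlgebraicGeometry.Resolution

universe u

variable {k K : Type u} [Field k] [Field K] [Algebra k K]

/-- The conclusion of Temkin's Thm. 4.1.1 (`n = 1`, non-logarithmic) for ONE affine model
`X = Spec A` of `K°` and ONE finite extension of valued fields `(K₁, K₁°)/(K, K°)`, **before the
final enlargement of `l`** (proof of Thm. 4.1.1, end of Step 4: "Thus, we achieve that the center
of each `Kᵢ` on `Xᵢ` is `l`-smooth"): `L₁ = LK₁ ⊇ L ⊇ l` (`l/k`, `L/K` purely inseparable,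
`K₁[L] = L₁`), an affine refinement `X′ = Spec A′` of `X` and the valuation ring `L₁°` over `K₁°`
whose centre on `Nr_{L₁}(X′)` is an `l`-SMOOTH point (not necessarily simple). Verbatim
`Temkin2013DescentConclusion` without its last two conjuncts.
[cite: Temkin2013, Thm. 4.1.1, proof, Step 4 (arXiv:0804.1554v3 p. 49)] -/
def Temkin2013DescentConclusionWeak (k K : Type u) [Field k] [Field K] [Algebra k K]
    (O : ValuationSubring K) (A : Subalgebra k K) (K₁ : Type u) [Field K₁] [Algebra K K₁]
    (O₁ : ValuationSubring K₁) : Prop :=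
  ∃ (L₁ : Type u) (_ : Field L₁) (_ : Algebra K₁ L₁) (_ : Algebra K L₁) (_ : Algebra k L₁)
    (_ : IsScalarTower K K₁ L₁) (_ : IsScalarTower k K L₁),
    FiniteDimensional K₁ L₁ ∧ IsPurelyInseparable K₁ L₁ ∧
    ∃ l : IntermediateField k L₁, FiniteDimensional k l ∧ IsPurelyInseparable k l ∧
    ∃ L : IntermediateField K L₁, (l : Set L₁) ⊆ (L : Set L₁) ∧ IsPurelyInseparable K L ∧
      Algebra.adjoin K₁ (L : Set L₁) = ⊤ ∧
    ∃ (A' : Subalgebra k K), A ≤ A' ∧ A'.toSubring ≤ O.toSubring ∧ A'.FG ∧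
      IsFractionRing A' K ∧
    ∃ O₁' : ValuationSubring L₁, O₁'.comap (algebraMap K₁ L₁) = O₁ ∧
    ∃ (N : Subalgebra l L₁) (hN : N.toSubring ≤ O₁'.toSubring),
      (N : Set L₁) = {x : L₁ | IsIntegral (A'.map (IsScalarTower.toAlgHom k K L₁)) x} ∧
      (N.restrictScalars k).FG ∧ IsFractionRing N L₁ ∧
      Algebra.IsSmoothAt l (centreIdeal N O₁' hN)

/-- The full conclusion of Thm. 4.1.1 (`l`-smooth AND simple AND regular centre) implies the
weak one. [folklore] -/
theorem Temkin2013DescentConclusion.weak (O : ValuationSubring K) {A : Subalgebra k K}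
    {K₁ : Type u} [Field K₁] [Algebra K K₁] {O₁ : ValuationSubring K₁}
    (h : Temkin2013DescentConclusion k K O A K₁ O₁) :
    Temkin2013DescentConclusionWeak k K O A K₁ O₁ := by
  obtain ⟨L₁, iF, iA1, iA, iAk, iT1, iT2, hfin, hpi, l, hlfin, hlpi, L, hlL, hLpi, hadj,
    A', hAA', hA'O, hA'fg, hA'fr, O₁', hO₁', N, hN, hNint, hNfg, hNfr, hsm, -, -⟩ := h
  exact ⟨L₁, iF, iA1, iA, iAk, iT1, iT2, hfin, hpi, l, hlfin, hlpi, L, hlL, hLpi, hadj,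
    A', hAA', hA'O, hA'fg, hA'fr, O₁', hO₁', N, hN, hNint, hNfg, hNfr, hsm⟩

/-- Refining the model is harmless for the weak conclusion (Temkin 2013, proof of Thm. 4.1.1,
Step 0, p. 47: "It suffices to prove the theorem for any affine model of `K°` which is finer
than `X`"). [cite: Temkin2013, proof of Thm. 4.1.1 Step 0 (p. 47)] -/
theorem Temkin2013DescentConclusionWeak.of_le (O : ValuationSubring K) {A A₁ : Subalgebra k K}
    (hAA₁ : A ≤ A₁) {K₁ : Type u} [Field K₁] [Algebra K K₁] {O₁ : ValuationSubring K₁}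
    (h : Temkin2013DescentConclusionWeak k K O A₁ K₁ O₁) :
    Temkin2013DescentConclusionWeak k K O A K₁ O₁ := by
  obtain ⟨L₁, iF, iA1, iA, iAk, iT1, iT2, hfin, hpi, l, hlfin, hlpi, L, hlL, hLpi, hadj,
    A', hA₁A', rest⟩ := h
  exact ⟨L₁, iF, iA1, iA, iAk, iT1, iT2, hfin, hpi, l, hlfin, hlpi, L, hlL, hLpi, hadj,
    A', hAA₁.trans hA₁A', rest⟩

end Literature.AlgebraicGeometry.Resolution
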